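import Mathlib
import HarnessLib
import Summits.ResolutionOfSingularities.ResolutionOfSingularities.Theorems.WildQuotientsWildQuotientResolutionS1aModelNodeAtlas
import Summits.ResolutionOfSingularities.ResolutionOfSingularities.Theorems.WildQuotientsWildQuotientResolutionS1aKillFreeShots

/-!
# S1a — THE GENERAL KILL LEAF: a cobordant kill certificate on a node chart carrying the formal locus makes the move a `KillsIn 1`

[OURS · L1 W4.5c · lead-1 g14; the X-scheme kill step made GERM-INDEPENDENT: the pattern of ✓`d4_move4`/✓`d4_killsIn_one` (D4KillLeaf1, 394 l.) and of the
move-1 block of ✓`d4_killsIn_four` («chart 0 is killed: its residual section is 1») extracted once, for plan-1 RULING R-F15h (b) «the TWO-SHOT family starts with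
trA»] — NOT statements of the manuscript; counted 0; AI-level work, weaker than expert review. Crux stmt-ResolutionOfSingularities-17941 `CyclicQuotientFourfolds`,
line `s1a-logminvertex` v13 (`stub_reachLowerInFX`).

THE LEAF. Model `M` with a node chart `W` (tame node `(B, 𝒜, σ, e)`, `σ^[p] = id`, intertwining `g₀`), a K1′-regular `σ`-adapted homogeneous weighted centre
`(f, w)` in `B` whose trace is the `G`-stable Rees filtration `𝒦` (Veronese degree `d`, support inside `W`), ADMISSIBLE as a centre of the game, a `σ`-fixed
cover `y_j` of its cobordant blow-up (`u′_i ∈ √(cover elements)`), and a COBORDANT KILL CERTIFICATE `g` for `(f, w, σ)` (`augIdeal σ_R ≤ (g)` and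
`(g)·𝔳^N ≤ augIdeal σ_R`; e.g. KC3∘KC5 `cobordantKillCert_of_chains`). If some node-atlas data `𝔄` on `M` has formal locus inside `W`, then `KillsIn 1 M`:
on every realisation, ✓`exists_moveAtlas_of_node` with the residual element `1` on EVERY producer chart (`(g)·c_j^N ≤ augIdeal σ_R` for the cover elements
`c_j = y_j t^{dk} ∈ 𝔳`, so `1 = c_j^N · c_j^{−N}` lies in the extended residual ideal) re-decorates the realisation with `F′ ⊆ π′⁻¹(F_𝔄 ∖ W) = ∅`.
* ★★★ `killsIn_one_of_nodeCert` — the leaf (every `p`, every model, every node chart);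
* `fLocus_eq_empty_of_nodeCert` — its content for one realisation.
-/

set_option linter.dupNamespace false

noncomputable section

open CategoryTheory Limits AlgebraicGeometry TopologicalSpace Topology Opposite
open Literature.AlgebraicGeometry.Resolution Literature.AlgebraicGeometry.RelativeSpec
open Summit.ResolutionOfSingularities.ResolutionOfSingularities.Theorems.WildQuotientResolution.S1
open Summit.ResolutionOfSingularities.ResolutionOfSingularities.Theorems.WildQuotientResolution.S1.NodeAtlas
open Summit.ResolutionOfSingularities.ResolutionOfSingularities.Theorems.WildQuotientResolution.S1.CoarseChart
open Summit.ResolutionOfSingularities.ResolutionOfSingularities.Theorems.WildQuotientResolution.S1.ProducerStep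
open Summit.ResolutionOfSingularities.ResolutionOfSingularities.Theorems.WildQuotientResolution.S1.NpFrame
open Summit.ResolutionOfSingularities.ResolutionOfSingularities.Theorems.WildQuotientResolution.S1.GoodCharts
open Summit.ResolutionOfSingularities.ResolutionOfSingularities.Theorems.WildQuotientResolution.S1.BlowupCharts
open Summit.ResolutionOfSingularities.ResolutionOfSingularities.Theorems.WildQuotientResolution.S1.KillCert
open Summit.ResolutionOfSingularities.ResolutionOfSingularities.Theorems.WildQuotientResolution.S1.ReesBigrading
open Summit.ResolutionOfSingularities.ResolutionOfSingularities.Theorems.WildQuotientResolution.BlowupExit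

namespace Summit.ResolutionOfSingularities.ResolutionOfSingularities.Theorems.WildQuotientResolution.S1.GameFrame.GModel

variable {p : ℕ} {X' X₁ : Scheme.{0}} {q : X' ⟶ X₁} {G : Type} [Group G] {ρ : G →* Aut X'} {g₀ : G}

/-- **One realisation of the leaf**: under the hypotheses of the module docstring, a realisation `M′` of the move `(𝒦, d)` through `π′` carries node-atlas
data with EMPTY formal locus. [OURS · L1 W4.5c · general kill leaf; NOT a statement of the manuscript] -/
theorem fLocus_eq_empty_of_nodeCert [Finite G] (hp : 0 < p) (hG : ∀ g : G, g ∈ Subgroup.zpowers g₀) (M M' : GModel p q G ρ g₀)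
    (𝔄 : NodeAtlasData p M.act g₀) (W : M.act.StableAffineOpens) (hW : IsAffineOpen W.1) (h𝔄W : 𝔄.fLocus ⊆ (W.1 : Set M.V))
    {m : ℕ} (r : Fin m → ℕ) {B : Type} [CommRing B] (𝒜 : (Π j : Fin m, ZMod (r j)) → AddSubgroup B) [GradedRing 𝒜] {c : ℕ}
    (f : Fin c → B) {δ : Fin c → Π j : Fin m, ZMod (r j)} (w : Fin c → ℕ) (hf : ∀ i, f i ∈ 𝒜 (δ i))
    (σ : B ≃+* B) (e : Γ(M.V, W.1) ≃+* ↥(𝒜 0)) (htame : IsTameNode p B 𝒜 σ) (hσp : ∀ x : B, (⇑σ)^[p] x = x)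
    (hσ : ∀ t : Γ(M.V, W.1), ((e ((M.act.aut g₀⁻¹).hom.appLE W.1 W.1 (W.2.1 g₀⁻¹).ge t) : ↥(𝒜 0)) : B) = σ ((e t : ↥(𝒜 0)) : B))
    (hw : ∀ i, 0 < w i) (hK1 : RingTheory.Sequence.IsRegular B (List.ofFn f)) (hK1' : IsRegularRing (B ⧸ Ideal.span (Set.range f)))
    (hσJ : ∀ n : ℕ, ((weightedFiltration f w).ideal n).map (σ : B →+* B) ≤ (weightedFiltration f w).ideal n)
    (𝒦 : ReesFiltration M.V) (d : ℕ) (h𝒦G : ∀ (g : G) (n : ℕ), (𝒦.ideal n).comap (M.act.aut g).hom = 𝒦.ideal n)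
    (h𝒦O : ∀ n, (𝒦.filtration ⟨W.1, hW⟩).ideal n = ((traceFiltration 𝒜 f w).ideal n).comap (e : Γ(M.V, W.1) →+* ↥(𝒜 0)))
    (hver : VeroneseNormalised 𝒜 f w d) (hsuppW : (((𝒦.ideal d).support : Set M.V)) ⊆ (W.1 : Set M.V))
    (π' : M'.V ⟶ M.V) (hbl : IsBlowup π' (𝒦.ideal d)) (hr : M'.r = π' ≫ M.r)
    (hcomm : ∀ g : G, (M'.act.aut g).hom ≫ π' = π' ≫ (M.act.aut g).hom)
    {k : ℕ} (hk : 0 < k) {L : ℕ} (y : Fin L → ↥(𝒜 0)) (hy : ∀ j, y j ∈ (traceFiltration 𝒜 f w).ideal (d * k)) (hσy : ∀ j, σ (y j : B) = y j)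
    (hrad : ∀ i : Fin c, cobordantAlgebra.u' f w i ∈ (Ideal.span (Set.range fun j => coverElement 𝒜 f w (d * k) (y j) (hy j))).radical)
    {g : ↥(cobordantAlgebra f w)} (hcert : CobordantKillCert f w σ hσJ hp hσp g) :
    ∃ 𝔄' : NodeAtlasData p M'.act g₀, 𝔄'.fLocus = ∅ := by
  classical
  have hd : 0 < d := hver.1
  have hdk : 0 < d * k := Nat.mul_pos hd hk
  obtain ⟨h1, N, hN⟩ := hcert
  -- the residual element `1` on every producer chart
  have hres : ∀ j, (1 : ChartRing 𝒜 f w (d * k) (y j) (hy j)) ∈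
      ((augmentationIdeal (sigmaR σ f w hσJ hp hσp)).colon (Ideal.span {g})).map (algebraMap _ (ChartRing 𝒜 f w (d * k) (y j) (hy j))) := by
    intro j
    have hcN : coverElement 𝒜 f w (d * k) (y j) (hy j) ^ N ∈ (augmentationIdeal (sigmaR σ f w hσJ hp hσp)).colon (Ideal.span {g}) := by
      rw [Ideal.mem_colon_span_singleton, mul_comm]
      exact hN (Ideal.mul_mem_mul (Ideal.mem_span_singleton_self g) (Ideal.pow_mem_pow (coverElement_mem_vertexIdeal f w 𝒜 hdk (y j) (hy j)) N))
    have hmap := Ideal.mem_map_of_mem (algebraMap _ (ChartRing 𝒜 f w (d * k) (y j) (hy j))) hcN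
    have hunit : algebraMap _ (ChartRing 𝒜 f w (d * k) (y j) (hy j)) (coverElement 𝒜 f w (d * k) (y j) (hy j) ^ N) *
        IsLocalization.Away.invSelf (coverElement 𝒜 f w (d * k) (y j) (hy j)) ^ N = 1 := by
      rw [map_pow, ← mul_pow, IsLocalization.Away.mul_invSelf, one_pow]
    rw [← hunit]
    exact Ideal.mul_mem_right _ _ hmap
  have hz0 : ∀ j : Fin L, ∀ _ : Fin 1, (1 : ChartRing 𝒜 f w (d * k) (y j) (hy j)) ∈ chartNodeGrading r 𝒜 f w hf (d * k) (y j) (hy j) 0 := by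
    intro j _
    letI := chartNodeGradedRing r 𝒜 f w hf (d * k) (y j) (hy j)
    exact SetLike.GradedOne.one_mem
  obtain ⟨OW, -, -, E, -, -, -, 𝔄', hF'⟩ := exists_moveAtlas_of_node hp hG M M' 𝔄 W hW r 𝒜 f w hf σ e htame hσp hσ hw hK1 hK1' hσJ 𝒦 d h𝒦G h𝒦O hver hsuppW
    π' hbl hr hcomm hk y hy hσy hrad g h1 (fun _ => 1) (fun j _ => 1) hz0 (fun j _ => hres j)
  refine ⟨𝔄', Set.eq_empty_iff_forall_notMem.mpr fun v hv => ?_⟩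
  rcases hF' hv with hold | hnew
  · exact hold.2 (h𝔄W hold.1)
  · obtain ⟨j, hvW, hvR⟩ := Set.mem_iUnion.mp hnew
    letI := chartNodeGradedRing r 𝒜 f w hf (d * k) (y j) (hy j)
    have h1 : (⟨1, hz0 j 0⟩ : ↥(chartNodeGrading r 𝒜 f w hf (d * k) (y j) (hy j) 0)) = 1 := Subtype.ext rfl
    refine hvR 0 ?_
    rw [h1, map_one, Scheme.basicOpen_of_isUnit _ isUnit_one]
    exact hvW

/-- ★★★ **THE GENERAL KILL LEAF.** Model `M` with node-atlas data `𝔄` whose formal locus lies in a node chart `W`; on `W` a tame node `(B, 𝒜, σ, e)`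
(`σ^[p] = id`, intertwining `g₀`), a K1′-regular `σ`-adapted homogeneous weighted centre `(f, w)` whose trace is the `G`-stable Rees filtration `𝒦` (Veronese
degree `d`, support inside `W`) and which is an ADMISSIBLE centre of the game, a `σ`-fixed cover `y` of the cobordant blow-up, and a COBORDANT KILL CERTIFICATE
for `(f, w, σ)`. Then `KillsIn 1 M`: every realisation carries node-atlas data with EMPTY formal locus (`fLocus_eq_empty_of_nodeCert`). Inputs = those of
✓`exists_moveAtlas_of_node` (minus the residual elements) + admissibility + the certificate; the root-chart special case with trivial node is
✓`killsIn_one_of_coveringKill`. [OURS · L1 W4.5c · two-shot engine, R-F15h (b); NOT a statement of the manuscript] -/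
theorem killsIn_one_of_nodeCert [Finite G] (hp : 0 < p) (hG : ∀ g : G, g ∈ Subgroup.zpowers g₀) (M : GModel p q G ρ g₀)
    (𝔄 : NodeAtlasData p M.act g₀) (W : M.act.StableAffineOpens) (hW : IsAffineOpen W.1) (h𝔄W : 𝔄.fLocus ⊆ (W.1 : Set M.V))
    {m : ℕ} (r : Fin m → ℕ) {B : Type} [CommRing B] (𝒜 : (Π j : Fin m, ZMod (r j)) → AddSubgroup B) [GradedRing 𝒜] {c : ℕ}
    (f : Fin c → B) {δ : Fin c → Π j : Fin m, ZMod (r j)} (w : Fin c → ℕ) (hf : ∀ i, f i ∈ 𝒜 (δ i))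
    (σ : B ≃+* B) (e : Γ(M.V, W.1) ≃+* ↥(𝒜 0)) (htame : IsTameNode p B 𝒜 σ) (hσp : ∀ x : B, (⇑σ)^[p] x = x)
    (hσ : ∀ t : Γ(M.V, W.1), ((e ((M.act.aut g₀⁻¹).hom.appLE W.1 W.1 (W.2.1 g₀⁻¹).ge t) : ↥(𝒜 0)) : B) = σ ((e t : ↥(𝒜 0)) : B))
    (hw : ∀ i, 0 < w i) (hK1 : RingTheory.Sequence.IsRegular B (List.ofFn f)) (hK1' : IsRegularRing (B ⧸ Ideal.span (Set.range f)))
    (hσJ : ∀ n : ℕ, ((weightedFiltration f w).ideal n).map (σ : B →+* B) ≤ (weightedFiltration f w).ideal n)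
    (𝒦 : ReesFiltration M.V) (d : ℕ) (hadm : IsAdmissibleCentre p M.act g₀ 𝒦 d)
    (h𝒦G : ∀ (g : G) (n : ℕ), (𝒦.ideal n).comap (M.act.aut g).hom = 𝒦.ideal n)
    (h𝒦O : ∀ n, (𝒦.filtration ⟨W.1, hW⟩).ideal n = ((traceFiltration 𝒜 f w).ideal n).comap (e : Γ(M.V, W.1) →+* ↥(𝒜 0)))
    (hver : VeroneseNormalised 𝒜 f w d) (hsuppW : (((𝒦.ideal d).support : Set M.V)) ⊆ (W.1 : Set M.V))
    {k : ℕ} (hk : 0 < k) {L : ℕ} (y : Fin L → ↥(𝒜 0)) (hy : ∀ j, y j ∈ (traceFiltration 𝒜 f w).ideal (d * k)) (hσy : ∀ j, σ (y j : B) = y j)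
    (hrad : ∀ i : Fin c, cobordantAlgebra.u' f w i ∈ (Ideal.span (Set.range fun j => coverElement 𝒜 f w (d * k) (y j) (hy j))).radical)
    {g : ↥(cobordantAlgebra f w)} (hcert : CobordantKillCert f w σ hσJ hp hσp g) : KillsIn 1 M := by
  refine (killsIn_succ_iff 0 M).mpr ⟨𝒦, d, hadm, fun M' hm => ?_⟩
  obtain ⟨π', hbl, -, hr, hcomm⟩ := hm
  obtain ⟨𝔄', h𝔄'⟩ := fLocus_eq_empty_of_nodeCert hp hG M M' 𝔄 W hW h𝔄W r 𝒜 f w hf σ e htame hσp hσ hw hK1 hK1' hσJ 𝒦 d h𝒦G h𝒦O hver hsuppW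
    π' hbl hr hcomm hk y hy hσy hrad hcert
  exact ⟨⟨𝔄'⟩, (killsIn_zero_iff M').mpr ⟨𝔄', h𝔄'⟩⟩

end Summit.ResolutionOfSingularities.ResolutionOfSingularities.Theorems.WildQuotientResolution.S1.GameFrame.GModel

end
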